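import Literature.Analysis.FluidPDE.BVEnergyStageBase
import Literature.Analysis.FluidPDE.BVEnergyStageJet
import Literature.Analysis.FluidPDE.BVEnergyStageFinal
import Literature.Analysis.FluidPDE.JetStepWeightedArithmetic
import HarnessLib

/-!
# The energy stage of Buckmaster–Vicol (Ann. of Math. 189 (2019), Prop. 2.1, §7), IV: the stage
  theorem with power-counting

Analysis/FluidPDE support file (everything proved). `EnergyPump.stage` chains
`EnergyPump.base_prep` (mollification at scale `ℓ = L^{-1/16}`, cut-off, gluing, pump weight,
rescaled stress), `EnergyPump.jet_prep` (the weighted intermittent-jet step at frequency scale `L`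
in the regime `JetStep.StepPars.RegimeW`, power-counted by `step_arith_weighted`) and
`EnergyPump.final_glue` (re-mollification at scale `ℓ₂ = L^{-8}` and gluing), and collapses all the
resulting sizes by a crude bookkeeping `|x| ≤ om^n L^e` (`EnergyPump.OB`) in a slack parameter
`om` dominating every nuisance quantity (the absolute constants, `1/T`, the `C²` size of the energy
profile, the level sizes `V = λ_q⁴`, `A = λ_q^{10}`, and `δ_{q+1}^{±1}`, `δ_{q+2}^{-1}`) under the
master condition `om^4000 ≤ L`. The output is a Navier–Stokes–Reynolds triple with
`C¹` size of the velocity `≤ L⁸`, stress of `L¹` size `≤ L^{-1/500} δ_{q+2}` and `C¹` size `≤ L^{20}`,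
energy gap in `[0, δ_{q+2}]` vanishing-stress zone `gap ≤ δ_{q+2}/100`, and `L²` increment
`≤ M₀ δ_{q+1}^{1/2}`; with `L = λ_{q+1}^{1/2}` this is Prop. 2.1 of BV 2019 at level `q`
(see `Literature/Barriers/NavierStokesRegularity/BuckmasterVicolNonuniquenessIterationProofs`).

## References

* T. Buckmaster, V. Vicol, Ann. of Math. 189 (2019) = arXiv:1709.10033, Prop. 2.1, §7. [`BuckmasterVicol2019Annals`]
* T. Buckmaster, V. Vicol, EMS Surv. Math. Sci. 6 (2019) = arXiv:1901.09023, Thm. 7.1, §7.7. [`BuckmasterVicol2020`]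
-/

noncomputable section

open MeasureTheory Set Filter Topology Function
open scoped InnerProductSpace ContDiff ENNReal NNReal

namespace Literature.Analysis.FluidPDE

namespace EnergyPump

open Literature.Analysis.FunctionSpaces FunctionSpaces.Torus Literature.Analysis.Calculus NashGeometric JetStep Mikado


/-! ## The bookkeeping `|x| ≤ om^n L^e` -/

/-- `|x| ≤ om^n L^e`. [folklore] -/
def OB (om L : ℝ) (n : ℕ) (e : ℝ) (x : ℝ) : Prop := |x| ≤ om ^ n * L ^ e

namespace OB

variable {om L : ℝ} {n m : ℕ} {e f x y : ℝ}

/-- [folklore] -/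
theorem le (h : OB om L n e x) : x ≤ om ^ n * L ^ e := (le_abs_self x).trans h

/-- [folklore] -/
theorem mono (h : OB om L n e x) (hω : 2 ≤ om) (hL : 1 ≤ L) (hn : n ≤ m) (he : e ≤ f) : OB om L m f x :=
  h.trans (mul_le_mul (pow_le_pow_right₀ (by linarith) hn) (Real.rpow_le_rpow_of_exponent_le hL he)
    (Real.rpow_nonneg (by linarith) e) (pow_nonneg (by linarith) m))

/-- `mono` with the target exponents given first (for use with dot notation). [folklore] -/
theorem wk (m : ℕ) (f : ℝ) (h : OB om L n e x) (hω : 2 ≤ om) (hL : 1 ≤ L) (hn : n ≤ m) (he : e ≤ f) : OB om L m f x := h.mono hω hL hn he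

/-- [folklore] -/
theorem of_eq (h : OB om L n e y) (hxy : x = y) : OB om L n e x := by rw [OB, hxy]; exact h

/-- [folklore] -/
theorem of_abs_le (h : OB om L n e y) (hxy : |x| ≤ |y|) : OB om L n e x := hxy.trans h

/-- [folklore] -/
theorem of_le (h : OB om L n e y) (hx : 0 ≤ x) (hxy : x ≤ y) : OB om L n e x :=
  h.of_abs_le (by rw [abs_of_nonneg hx, abs_of_nonneg (hx.trans hxy)]; exact hxy)

/-- [folklore] -/
theorem mul (h1 : OB om L n e x) (h2 : OB om L m f y) (hL : 1 ≤ L) : OB om L (n + m) (e + f) (x * y) := by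
  unfold OB at *
  rw [abs_mul, pow_add, Real.rpow_add (by linarith), mul_mul_mul_comm]
  exact mul_le_mul h1 h2 (abs_nonneg y) ((abs_nonneg x).trans h1)

/-- [folklore] -/
theorem add (h1 : OB om L n e x) (h2 : OB om L n e y) (hω : 2 ≤ om) : OB om L (n + 1) e (x + y) := by
  unfold OB at *
  have h0 : 0 ≤ om ^ n * L ^ e := (abs_nonneg x).trans h1
  calc |x + y| ≤ |x| + |y| := abs_add_le x y
    _ ≤ 2 * (om ^ n * L ^ e) := by linarith
    _ ≤ om * (om ^ n * L ^ e) := mul_le_mul_of_nonneg_right hω h0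
    _ = om ^ (n + 1) * L ^ e := by rw [pow_succ]; ring

/-- [folklore] -/
theorem neg (h : OB om L n e x) : OB om L n e (-x) := by unfold OB at *; rwa [abs_neg]

/-- [folklore] -/
theorem sub (h1 : OB om L n e x) (h2 : OB om L n e y) (hω : 2 ≤ om) : OB om L (n + 1) e (x - y) :=
  (h1.add h2.neg hω).of_eq (sub_eq_add_neg x y)

/-- [folklore] -/
theorem sqrt (h : OB om L n e x) (hω : 2 ≤ om) (hL : 1 ≤ L) : OB om L n (e / 2) (Real.sqrt x) := by
  unfold OB at *
  have hω1 : 1 ≤ om ^ n := one_le_pow₀ (by linarith)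
  rw [abs_of_nonneg (Real.sqrt_nonneg x)]
  calc Real.sqrt x ≤ Real.sqrt |x| := Real.sqrt_le_sqrt (le_abs_self x)
    _ ≤ Real.sqrt (om ^ n * L ^ e) := Real.sqrt_le_sqrt h
    _ = Real.sqrt (om ^ n) * L ^ (e / 2) := by
        rw [Real.sqrt_mul (by positivity), Real.sqrt_eq_rpow (L ^ e), ← Real.rpow_mul (by linarith)]; ring_nf
    _ ≤ om ^ n * L ^ (e / 2) := by
        refine mul_le_mul_of_nonneg_right ?_ (Real.rpow_nonneg (by linarith) _)
        rw [Real.sqrt_le_left (by positivity)]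
        nlinarith

/-- [folklore] -/
theorem pow_two (h : OB om L n e x) (hL : 1 ≤ L) : OB om L (n + n) (e + e) (x ^ 2) := (h.mul h hL).of_eq (sq x)

/-- [folklore] -/
theorem max0 (h : OB om L n e x) : OB om L n e (max 0 x) := by
  refine h.of_abs_le ?_
  rcases le_or_gt 0 x with hx | hx
  · rw [max_eq_right hx]
  · rw [max_eq_left hx.le, abs_zero]; exact abs_nonneg x

/-- [folklore] -/
theorem max1 (h : OB om L n e x) (hω : 2 ≤ om) (hL : 1 ≤ L) (he : 0 ≤ e) : OB om L n e (max 1 x) := by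
  unfold OB at *
  have h1 : (1 : ℝ) ≤ om ^ n * L ^ e := one_le_mul_of_one_le_of_one_le (one_le_pow₀ (by linarith)) (Real.one_le_rpow hL he)
  rw [abs_of_nonneg (le_trans zero_le_one (le_max_left _ _))]
  exact max_le h1 ((le_abs_self x).trans h)

/-- [folklore] -/
theorem of_le_omega (hx : |x| ≤ om) (L : ℝ) : OB om L 1 0 x := by unfold OB; rw [pow_one, Real.rpow_zero, mul_one]; exact hx

/-- [folklore] -/
theorem of_nonneg_le_omega (h0 : 0 ≤ x) (hx : x ≤ om) (L : ℝ) : OB om L 1 0 x := of_le_omega (by rwa [abs_of_nonneg h0]) L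

/-- [folklore] -/
theorem of_le_one (hx : |x| ≤ 1) (om L : ℝ) : OB om L 0 0 x := by
  unfold OB; rw [pow_zero, Real.rpow_zero, mul_one]; exact hx

/-- [folklore] -/
theorem rpow (om : ℝ) (hL : 1 ≤ L) (e : ℝ) : OB om L 0 e (L ^ e) := by
  unfold OB; rw [pow_zero, one_mul, abs_of_nonneg (Real.rpow_nonneg (by linarith) e)]

/-- [folklore] -/
theorem npow (om : ℝ) (hL : 1 ≤ L) (k : ℕ) : OB om L 0 k (L ^ k) := (rpow om hL k).of_eq (Real.rpow_natCast L k).symm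

/-- The master condition `om^4000 ≤ L` turns `OB` into a pure power of `L`. [folklore] -/
theorem final (h : OB om L n e x) (hω : 2 ≤ om) (hL : 1 ≤ L) (hM : om ^ 4000 ≤ L) : |x| ≤ L ^ ((n : ℝ) / 4000 + e) := by
  have hω0 : 0 ≤ om := by linarith
  have h1 : om ≤ L ^ (1 / 4000 : ℝ) := by
    have : (om ^ 4000) ^ (1 / 4000 : ℝ) ≤ L ^ (1 / 4000 : ℝ) := Real.rpow_le_rpow (by positivity) hM (by norm_num)
    rwa [← Real.rpow_natCast, ← Real.rpow_mul hω0, show ((4000 : ℕ) : ℝ) * (1 / 4000 : ℝ) = 1 by norm_num, Real.rpow_one] at this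
  have h2 : om ^ n ≤ L ^ ((n : ℝ) / 4000) := by
    calc om ^ n ≤ (L ^ (1 / 4000 : ℝ)) ^ n := pow_le_pow_left₀ hω0 h1 n
      _ = L ^ ((n : ℝ) / 4000) := by rw [← Real.rpow_natCast, ← Real.rpow_mul (by linarith)]; ring_nf
  calc |x| ≤ om ^ n * L ^ e := h
    _ ≤ L ^ ((n : ℝ) / 4000) * L ^ e := mul_le_mul_of_nonneg_right h2 (Real.rpow_nonneg (by linarith) e)
    _ = L ^ ((n : ℝ) / 4000 + e) := by rw [← Real.rpow_add (by linarith)]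

/-- `L ≥ 2^4000`. [folklore] -/
theorem two_pow_le (hω : 2 ≤ om) (hM : om ^ 4000 ≤ L) : (2 : ℝ) ^ 4000 ≤ L := (pow_le_pow_left₀ (by norm_num) hω 4000).trans hM

/-- `x ≤ L^f / 5` once `n/4000 + e + 1 ≤ f`. [folklore] -/
theorem le_div_five (h : OB om L n e x) (hω : 2 ≤ om) (hL : 1 ≤ L) (hM : om ^ 4000 ≤ L) (hf : (n : ℝ) / 4000 + e + 1 ≤ f) : x ≤ L ^ f / 5 := by
  have h1 := (le_abs_self x).trans (h.final hω hL hM)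
  have hL5 : (5 : ℝ) ≤ L := le_trans ((by norm_num : (5:ℝ) ≤ 2 ^ 3).trans (pow_le_pow_right₀ (by norm_num) (by norm_num))) (two_pow_le hω hM)
  have hLpos : 0 < L := lt_of_lt_of_le one_pos hL
  rw [le_div_iff₀ (by norm_num : (0:ℝ) < 5)]
  calc x * 5 ≤ L ^ ((n : ℝ) / 4000 + e) * L := mul_le_mul h1 hL5 (by norm_num) (Real.rpow_nonneg hLpos.le _)
    _ = L ^ ((n : ℝ) / 4000 + e + 1) := by rw [Real.rpow_add hLpos ((n : ℝ) / 4000 + e) 1, Real.rpow_one]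
    _ ≤ L ^ f := Real.rpow_le_rpow_of_exponent_le hL hf

/-- `x ≤ L^f · y` once `y⁻¹ ≤ om`, `y > 0` and `(n+1)/4000 + e ≤ f`. [folklore] -/
theorem le_mul_of_inv_le (h : OB om L n e x) (hω : 2 ≤ om) (hL : 1 ≤ L) (hM : om ^ 4000 ≤ L) {y : ℝ} (hy : 0 < y) (hyω : y⁻¹ ≤ om)
    (hf : ((n : ℝ) + 1) / 4000 + e ≤ f) : x ≤ L ^ f * y := by
  have hy' : OB om L 1 0 y⁻¹ := of_le_omega (by rwa [abs_of_pos (inv_pos.2 hy)]) L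
  have h2 : OB om L (n + 1) (e + 0) (x * y⁻¹) := h.mul hy' hL
  have h3 := (le_abs_self _).trans (h2.final hω hL hM)
  rw [← div_le_iff₀ hy, div_eq_mul_inv]
  refine h3.trans (Real.rpow_le_rpow_of_exponent_le hL ?_)
  push_cast; linarith

/-- `x ≤ y / 256` once `y⁻¹ ≤ om`, `y > 0` and `(n+1)/4000 + e ≤ -1/500`. [folklore] -/
theorem le_div_of_inv_le (h : OB om L n e x) (hω : 2 ≤ om) (hL : 1 ≤ L) (hM : om ^ 4000 ≤ L) {y : ℝ} (hy : 0 < y) (hyω : y⁻¹ ≤ om)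
    (hf : ((n : ℝ) + 1) / 4000 + e ≤ -(1 / 500)) : x ≤ y / 256 := by
  have h1 := h.le_mul_of_inv_le hω hL hM hy hyω hf
  have h2 : L ^ (-(1 / 500 : ℝ)) ≤ 1 / 256 := by
    have hL2 := two_pow_le hω hM
    have hLpos : 0 < L := lt_of_lt_of_le one_pos hL
    have h256 : (256 : ℝ) ≤ L ^ ((500 : ℕ) : ℝ)⁻¹ := by
      have e1 : (256 : ℝ) = ((256 : ℝ) ^ 500) ^ ((500 : ℕ) : ℝ)⁻¹ := (Real.pow_rpow_inv_natCast (by norm_num) (by norm_num)).symm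
      have e2 : (256 : ℝ) ^ 500 = 2 ^ 4000 := by rw [show (256 : ℝ) = 2 ^ 8 by norm_num, ← pow_mul]
      rw [e1, e2]; exact Real.rpow_le_rpow (by positivity) hL2 (by positivity)
    rw [show (-(1 / 500 : ℝ)) = -(((500 : ℕ) : ℝ)⁻¹) by norm_num, Real.rpow_neg hLpos.le, one_div]
    exact inv_anti₀ (by norm_num) h256
  calc x ≤ L ^ (-(1 / 500 : ℝ)) * y := h1
    _ ≤ 1 / 256 * y := mul_le_mul_of_nonneg_right h2 hy.le
    _ = y / 256 := by ring

/-- `|x| ≤ 1` once `n/4000 + e ≤ 0`. [folklore] -/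
theorem le_one (h : OB om L n e x) (hω : 2 ≤ om) (hL : 1 ≤ L) (hM : om ^ 4000 ≤ L) (hf : (n : ℝ) / 4000 + e ≤ 0) : |x| ≤ 1 :=
  (h.final hω hL hM).trans (Real.rpow_le_one_of_one_le_of_nonpos hL hf)

end OB

/-! ## Small numerical facts -/

/-- `r = 1/10` for the Nash radius in dimension `3`. [folklore] -/
theorem radius_fin_three : radius (Fin 3) = 1 / 10 := by
  unfold NashGeometric.radius; norm_num [Fintype.card_fin]

/-- `om^4000 ≤ L ⇒ om^{4000 s} ≤ L^s` for `s ≥ 0`. [folklore] -/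
theorem omega_pow_le_rpow {om L : ℝ} (hω : 2 ≤ om) (hM : om ^ 4000 ≤ L) {s : ℝ} (hs : 0 ≤ s) : om ^ (4000 * s) ≤ L ^ s := by
  have hω0 : 0 ≤ om := by linarith
  calc om ^ (4000 * s) = (om ^ (4000 : ℕ)) ^ s := by rw [Real.rpow_mul hω0]; norm_num
    _ ≤ L ^ s := Real.rpow_le_rpow (by positivity) hM hs

/-- `L^{-(1/16)} ≤ 1/4` under the master condition. [folklore] -/
theorem rpow_neg_sixteenth_le {om L : ℝ} (hω : 2 ≤ om) (hL : 1 ≤ L) (hM : om ^ 4000 ≤ L) : L ^ (-(1 / 16 : ℝ)) ≤ 1 / 4 := by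
  have hL2 := OB.two_pow_le hω hM
  have hLpos : 0 < L := lt_of_lt_of_le one_pos hL
  have h4 : (4 : ℝ) ≤ L ^ ((16 : ℕ) : ℝ)⁻¹ := by
    have e1 : (4 : ℝ) = ((4 : ℝ) ^ 16) ^ ((16 : ℕ) : ℝ)⁻¹ := (Real.pow_rpow_inv_natCast (by norm_num) (by norm_num)).symm
    have e2 : (4 : ℝ) ^ 16 ≤ 2 ^ 4000 := by rw [show (4 : ℝ) = 2 ^ 2 by norm_num, ← pow_mul]; exact pow_le_pow_right₀ (by norm_num) (by norm_num)
    rw [e1]; exact Real.rpow_le_rpow (by positivity) (e2.trans hL2) (by positivity)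
  rw [show (-(1 / 16 : ℝ)) = -(((16 : ℕ) : ℝ)⁻¹) by norm_num, Real.rpow_neg hLpos.le, one_div]
  exact inv_anti₀ (by norm_num) h4

set_option maxHeartbeats 3000000 in
/-- **The energy stage of BV 2019, Prop. 2.1 (power-counted form).** See the module docstring.
[cite: BuckmasterVicol2019Annals, Prop. 2.1, §7; BuckmasterVicol2020, Thm. 7.1, §7.7] -/
theorem stage : ∃ C₀ : ℝ, 1 ≤ C₀ ∧ ∃ M₀ : ℝ, 0 < M₀ ∧ ∀ T : ℝ, 0 < T → ∃ om₀ : ℝ, 2 ≤ om₀ ∧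
    ∀ (ν : ℝ) (e : ℝ → ℝ) (E₁ E₂ : ℝ) (v : ℝ → (UnitAddTorus (Fin 3)) → (EuclideanSpace ℝ (Fin 3))) (p : ℝ → (UnitAddTorus (Fin 3)) → ℝ) (R : ℝ → (UnitAddTorus (Fin 3)) → Fin 3 → (EuclideanSpace ℝ (Fin 3)))
      (V A δR Δ δ L om : ℝ) (σN : ℕ),
    0 < ν → ν ≤ 1 → ContDiffOn ℝ ∞ e (Icc 0 T) →
    (∀ t ∈ Icc 0 T, |derivWithin e (Icc 0 T) t| ≤ E₁) → (∀ t ∈ Icc 0 T, |derivWithin (derivWithin e (Icc 0 T)) (Icc 0 T) t| ≤ E₂) →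
    E₁ ≤ om → E₂ ≤ om → om₀ ≤ om →
    Torus.IsNSReynoldsOn (Icc 0 T) ν v p R → (∀ t ∈ Icc 0 T, HasZeroMean (v t)) →
    1 ≤ V → V ≤ om → (∀ t ∈ Icc 0 T, ∀ x, ‖v t x‖ ≤ V) → (∀ i, ∀ t ∈ Icc 0 T, ∀ x, ‖Torus.partialDeriv i (v t) x‖ ≤ V) →
    (∀ t ∈ Icc 0 T, ∀ x, ‖Torus.timeDerivWithin (Icc 0 T) v t x‖ ≤ V) →
    1 ≤ A → A ≤ om → (∀ t ∈ Icc 0 T, ∀ x, ‖R t x‖ ≤ A) → 0 < δR → (∀ t ∈ Icc 0 T, ∫ x, ‖R t x‖ ≤ δR) →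
    0 < δ → δ ≤ Δ / 100 → 0 < Δ → Δ ≤ om → Δ⁻¹ ≤ om → δ⁻¹ ≤ om →
    (∀ t ∈ Icc 0 T, 0 ≤ e t - ∫ x, ‖v t x‖ ^ 2 ∧ e t - ∫ x, ‖v t x‖ ^ 2 ≤ Δ) →
    (∀ t ∈ Icc 0 T, e t - ∫ x, ‖v t x‖ ^ 2 ≤ Δ / 100 → ∀ x, R t x = 0) →
    1 ≤ L → om ^ 4000 ≤ L → (σN : ℝ) = L ^ (3 / 16 : ℝ) →
    C₀ * δR ≤ δ → C₀ * V ≤ (L ^ (1 / B0)) ^ 4 → C₀ * A ≤ (L ^ (1 / B0)) ^ 10 →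
    Δ / 30 ≤ L ^ (1 / (20 * B0)) → L ^ (-(1 / (20 * B0))) ≤ Δ / 30 →
    ∃ (vn : ℝ → (UnitAddTorus (Fin 3)) → (EuclideanSpace ℝ (Fin 3))) (pn : ℝ → (UnitAddTorus (Fin 3)) → ℝ) (Rn : ℝ → (UnitAddTorus (Fin 3)) → Fin 3 → (EuclideanSpace ℝ (Fin 3))),
      Torus.IsNSReynoldsOn (Icc 0 T) ν vn pn Rn ∧ (∀ t ∈ Icc 0 T, HasZeroMean (vn t)) ∧
      (∀ t ∈ Icc 0 T, ∀ x, ‖vn t x‖ ≤ L ^ (8 : ℝ) / 5) ∧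
      (∀ i, ∀ t ∈ Icc 0 T, ∀ x, ‖Torus.partialDeriv i (vn t) x‖ ≤ L ^ (8 : ℝ) / 5) ∧
      (∀ t ∈ Icc 0 T, ∀ x, ‖Torus.timeDerivWithin (Icc 0 T) vn t x‖ ≤ L ^ (8 : ℝ) / 5) ∧
      (∀ t ∈ Icc 0 T, ∫ x, ‖Rn t x‖ ≤ L ^ (-(1 / 500 : ℝ)) * δ) ∧
      (∀ t ∈ Icc 0 T, ∀ x, ‖Rn t x‖ ≤ L ^ (20 : ℝ) / 5) ∧
      (∀ l, ∀ t ∈ Icc 0 T, ∀ x, ‖Torus.partialDeriv l (Rn t) x‖ ≤ L ^ (20 : ℝ) / 5) ∧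
      (∀ t ∈ Icc 0 T, ∀ x, ‖Torus.timeDerivWithin (Icc 0 T) Rn t x‖ ≤ L ^ (20 : ℝ) / 5) ∧
      (∀ t ∈ Icc 0 T, 0 ≤ e t - ∫ x, ‖vn t x‖ ^ 2 ∧ e t - ∫ x, ‖vn t x‖ ^ 2 ≤ δ) ∧
      (∀ t ∈ Icc 0 T, e t - ∫ x, ‖vn t x‖ ^ 2 ≤ δ / 100 → ∀ x, Rn t x = 0) ∧
      (∀ t ∈ Icc 0 T, eLpNorm (vn t - v t) 2 volume ≤ ENNReal.ofReal (M₀ * Real.sqrt Δ)) := by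
  -- ### the absolute constants
  obtain ⟨C, hC1, K, hK0, hbase⟩ := base_prep
  obtain ⟨c, hc, hCp, hjet⟩ := jet_prep
  obtain ⟨Cf, hCf1, Kf, hKf0, hfinal⟩ := final_glue
  obtain ⟨Ma, hMa, harith⟩ := StepPars.step_arith_weighted hc
  have hC0 : 0 ≤ C := by linarith
  have hCf0 : 0 ≤ Cf := by linarith
  have hD10 : 0 ≤ D₁ := D₁_nonneg
  have hD20 : 0 ≤ D₂ := D₂_nonneg
  refine ⟨100000000 * C, by linarith, Ma + 1, by linarith, fun T hT => ?_⟩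
  obtain ⟨L₀, hL₀1, harithT⟩ := harith T
  -- the slack threshold: dominates every absolute constant, `1/T` and the arithmetic threshold
  set om₀ : ℝ := 200000 + C + K + Cf + Kf + D₁ + D₂ + Ma + L₀ + pipeConc + T⁻¹ with hω₀
  have hTinv : 0 < T⁻¹ := inv_pos.2 hT
  have hpipe : (0:ℝ) ≤ pipeConc := by unfold Mikado.pipeConc; norm_num
  refine ⟨om₀, by simp only [hω₀]; linarith [hMa.le, hTinv.le], ?_⟩
  intro ν e E₁ E₂ v p R V A δR Δ δ L om σN hν hν1 he hE₁ hE₂ hE₁ω hE₂ω hω₀ω hns hmean hV1 hVω hv0 hv1 hvt hA1 hAω hRA hδR hRδ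
    hδ hδΔ hΔ hΔω hΔiω hδiω hgap hR0 hL hM hσN hC₀δ hC₀V hC₀A hγ1 hγlow
  -- ### unpacking the slack parameter
  have hω : 2 ≤ om := by simp only [hω₀] at hω₀ω; linarith [hMa.le, hTinv.le]
  have hω0 : 0 ≤ om := by linarith
  have hLpos : 0 < L := by linarith
  have hωL : om ≤ L := by
    calc om = om ^ 1 := (pow_one om).symm
      _ ≤ om ^ 4000 := pow_le_pow_right₀ (by linarith) (by norm_num)
      _ ≤ L := hM
  have hE₁0 : 0 ≤ E₁ := (abs_nonneg _).trans (hE₁ 0 ⟨le_rfl, hT.le⟩)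
  have hE₂0 : 0 ≤ E₂ := (abs_nonneg _).trans (hE₂ 0 ⟨le_rfl, hT.le⟩)
  have hV0 : 0 ≤ V := by linarith
  have hA0 : 0 ≤ A := by linarith
  -- primitive `OB` facts
  have hω₀' : 200000 + C + K + Cf + Kf + D₁ + D₂ + Ma + L₀ + pipeConc + T⁻¹ ≤ om := by simpa only [hω₀] using hω₀ω
  have oC : OB om L 1 0 C := OB.of_nonneg_le_omega hC0 (by linarith only [hω₀', hC0, hK0, hCf0, hKf0, hD10, hD20, hMa.le, hL₀1, hpipe, hTinv.le]) L
  have oK : OB om L 1 0 K := OB.of_nonneg_le_omega hK0 (by linarith only [hω₀', hC0, hK0, hCf0, hKf0, hD10, hD20, hMa.le, hL₀1, hpipe, hTinv.le]) L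
  have oCf : OB om L 1 0 Cf := OB.of_nonneg_le_omega hCf0 (by linarith only [hω₀', hC0, hK0, hCf0, hKf0, hD10, hD20, hMa.le, hL₀1, hpipe, hTinv.le]) L
  have oKf : OB om L 1 0 Kf := OB.of_nonneg_le_omega hKf0 (by linarith only [hω₀', hC0, hK0, hCf0, hKf0, hD10, hD20, hMa.le, hL₀1, hpipe, hTinv.le]) L
  have oD₁ : OB om L 1 0 D₁ := OB.of_nonneg_le_omega hD10 (by linarith only [hω₀', hC0, hK0, hCf0, hKf0, hD10, hD20, hMa.le, hL₀1, hpipe, hTinv.le]) L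
  have oD₁' : OB om L 1 0 (D₁ + 1) := OB.of_nonneg_le_omega (by linarith) (by linarith only [hω₀', hC0, hK0, hCf0, hKf0, hD10, hD20, hMa.le, hL₀1, hpipe, hTinv.le]) L
  have oD₂ : OB om L 1 0 D₂ := OB.of_nonneg_le_omega hD20 (by linarith only [hω₀', hC0, hK0, hCf0, hKf0, hD10, hD20, hMa.le, hL₀1, hpipe, hTinv.le]) L
  have oMa : OB om L 1 0 Ma := OB.of_nonneg_le_omega hMa.le (by linarith only [hω₀', hC0, hK0, hCf0, hKf0, hD10, hD20, hL₀1, hpipe, hTinv.le]) L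
  have oTi : OB om L 1 0 T⁻¹ := OB.of_nonneg_le_omega hTinv.le (by linarith only [hω₀', hC0, hK0, hCf0, hKf0, hD10, hD20, hMa.le, hL₀1, hpipe]) L
  have oTi' : OB om L 1 0 (1 / T) := oTi.of_eq (one_div T)
  have oE₁ : OB om L 1 0 E₁ := OB.of_nonneg_le_omega hE₁0 hE₁ω L
  have oE₂ : OB om L 1 0 E₂ := OB.of_nonneg_le_omega hE₂0 hE₂ω L
  have oV : OB om L 1 0 V := OB.of_nonneg_le_omega hV0 hVω L
  have oA : OB om L 1 0 A := OB.of_nonneg_le_omega hA0 hAω L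
  have oΔ : OB om L 1 0 Δ := OB.of_nonneg_le_omega hΔ.le hΔω L
  have oδ : OB om L 1 0 δ := OB.of_nonneg_le_omega hδ.le (by linarith) L
  have oΔi : OB om L 1 0 Δ⁻¹ := OB.of_nonneg_le_omega (inv_pos.2 hΔ).le hΔiω L
  have oδi : OB om L 1 0 δ⁻¹ := OB.of_nonneg_le_omega (inv_pos.2 hδ).le hδiω L
  have onum : ∀ x : ℝ, 0 ≤ x → x ≤ 200000 → OB om L 1 0 x := fun x h0 hx =>
    OB.of_nonneg_le_omega h0 (by linarith only [hx, hω₀', hC0, hK0, hCf0, hKf0, hD10, hD20, hMa.le, hL₀1, hpipe, hTinv.le]) L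
  have o2 : OB om L 1 0 (2:ℝ) := onum 2 (by norm_num) (by norm_num)
  have ohalf : OB om L 0 0 (1 / 2 : ℝ) := OB.of_le_one (by norm_num) om L
  have oVV : OB om L 2 0 (V + V) := oV.add oV hω
  -- the scales
  set ℓ : ℝ := L ^ (-(1 / 16 : ℝ)) with hℓdef
  have hℓpos : 0 < ℓ := Real.rpow_pos_of_pos hLpos _
  have hℓinv : ℓ⁻¹ = L ^ (1 / 16 : ℝ) := by rw [hℓdef, Real.rpow_neg hLpos.le, inv_inv]
  have hℓi0 : 0 ≤ ℓ⁻¹ := inv_nonneg.2 hℓpos.le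
  have oℓ : OB om L 0 (-(1 / 16)) ℓ := OB.rpow om hL _
  have oℓi : OB om L 0 (1 / 16) ℓ⁻¹ := (OB.rpow om hL _).of_eq hℓinv
  have oℓi2 : OB om L 0 (1 / 8) (ℓ⁻¹ ^ 2) := (oℓi.pow_two hL).wk 0 (1 / 8) hω hL (by norm_num) (by norm_num)
  have hℓ4 : ℓ ≤ 1 / 4 := rpow_neg_sixteenth_le hω hL hM
  have hℓT : 8 * ℓ ≤ T := by
    have h1 : OB om L 2 (-(1 / 16)) (8 * T⁻¹ * ℓ) :=
      (((onum 8 (by norm_num) (by norm_num)).mul oTi hL).mul oℓ hL).wk 2 (-(1 / 16)) hω hL (by norm_num) (by norm_num)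
    have h2 := (le_abs_self _).trans (h1.le_one hω hL hM (by norm_num))
    rw [show 8 * T⁻¹ * ℓ = 8 * ℓ / T by ring, div_le_one hT] at h2
    exact h2
  -- ### Step 1: preparation of the base triple
  have oD₀ : OB om L 3 (-(1 / 16)) (C * (V + V) * ℓ) := ((oC.mul oVV hL).mul oℓ hL).wk 3 (-(1 / 16)) hω hL (by norm_num) (by norm_num)
  have oη : OB om L 7 (-(1 / 16)) ((2 * (C * V) + C * (V + V) * ℓ) * (C * (V + V) * ℓ)) :=
    ((((o2.mul (oC.mul oV hL) hL).wk 3 0 hω hL (by norm_num) (by norm_num)).add (oD₀.wk 3 0 hω hL (by norm_num) (by norm_num)) hω).mul oD₀ hL).wk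
      7 (-(1 / 16)) hω hL (by norm_num) (by norm_num)
  have hsmall₁ : (2 * (C * V) + C * (V + V) * ℓ) * (C * (V + V) * ℓ) + 7 * ℓ * (E₁ + 2 * V * V) ≤ Δ / 200 := by
    have o3 : OB om L 6 (-(1 / 16)) (7 * ℓ * (E₁ + 2 * V * V)) :=
      ((((onum 7 (by norm_num) (by norm_num)).mul oℓ hL).mul ((oE₁.wk 3 0 hω hL (by norm_num) (by norm_num)).add
        (((o2.mul oV hL).mul oV hL).wk 3 0 hω hL (by norm_num) (by norm_num)) hω) hL)).wk 6 (-(1 / 16)) hω hL (by norm_num) (by norm_num)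
    have o4 := oη.add (o3.wk 7 (-(1 / 16)) hω hL (by norm_num) (by norm_num)) hω
    have := o4.le_div_of_inv_le hω hL hM hΔ hΔiω (by norm_num)
    linarith only [this, hΔ]
  obtain ⟨vb, pb, Rcb, N, s, θ, Gm, D₀, η, Λ₁, Λ₂, Θ₁, Θ₂, S', ρc, Vb, Sb₁, Sb₂, hD₀, hη, hΛ₁, hΛ₂, hΘ₁, hΘ₂, hS', hρc, hVb, hSb₁, hSb₂,
    hNSRb, hvbmean, hRcbS, hRcbsym, hRcbtr, hNS, hNsym, hss, hs01, hs', hsflat, hs_zero, hθs, hθ01, hθ', hθ'', hθne1, hθne0, hθflat,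
    hvb0, hvb1, hvbt, hRcb0, hN0, hN1, hNt, hN2, hNt1, hNL1, hGms, hGGm, hGbGm, hvbv, hs_sq, -, huntouched, hquiet⟩ :=
    hbase T ν e E₁ E₂ v p R V A δR Δ δ ℓ hT he hE₁ hE₂ hns hmean hV1 hv0 hv1 hvt hA1 hRA hδR hRδ hδ hδΔ hgap hR0 hℓpos hℓ4 hℓT hsmall₁
  -- signs and `OB` of the derived sizes
  have hΛ₁0 : 0 ≤ Λ₁ := by rw [hΛ₁]; positivity
  have hΛ₂0 : 0 ≤ Λ₂ := by rw [hΛ₂]; positivity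
  have hΘ₁0 : 0 ≤ Θ₁ := by rw [hΘ₁]; positivity
  have hΘ₂0 : 0 ≤ Θ₂ := by rw [hΘ₂]; positivity
  have hD₀0 : 0 ≤ D₀ := by rw [hD₀]; positivity
  have hSb₁0 : 0 ≤ Sb₁ := by rw [hSb₁]; positivity
  have hSb₂0 : 0 ≤ Sb₂ := by rw [hSb₂]; positivity
  have hS'0 : 0 ≤ S' := (abs_nonneg _).trans (hs' 0 ⟨le_rfl, hT.le⟩)
  have hρc0 : 0 ≤ ρc := (norm_nonneg _).trans (hRcb0 0 ⟨le_rfl, hT.le⟩ 0)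
  have oD₀' : OB om L 3 (-(1 / 16)) D₀ := oD₀.of_eq hD₀
  have oη' : OB om L 7 (-(1 / 16)) η := by rw [hη, hD₀]; exact oη
  have oΛ₁ : OB om L 7 0 Λ₁ := by
    rw [hΛ₁]
    exact ((oE₁.wk 6 0 hω hL (by norm_num) (by norm_num)).add
      (((o2.mul (oC.mul oV hL) hL).mul (oC.mul oVV hL) hL).wk 6 0 hω hL (by norm_num) (by norm_num)) hω).wk 7 0 hω hL (by norm_num) (by norm_num)
  have oΛ₂ : OB om L 9 (1 / 8) Λ₂ := by
    rw [hΛ₂]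
    refine ((oE₂.wk 8 (1 / 8) hω hL (by norm_num) (by norm_num)).add ?_ hω).wk 9 (1 / 8) hω hL (by norm_num) (by norm_num)
    exact (o2.mul ((((oC.mul oVV hL).mul (oC.mul oVV hL) hL).wk 6 (1 / 8) hω hL (by norm_num) (by norm_num)).add
      (((oC.mul oV hL).mul ((oC.mul oV hL).mul oℓi2 hL) hL).wk 6 (1 / 8) hω hL (by norm_num) (by norm_num)) hω) hL).wk 8 (1 / 8) hω hL (by norm_num) (by norm_num)
  have oΘ₁ : OB om L 10 0 Θ₁ := by
    rw [hΘ₁]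
    have e1 : D₁ / (δ / 8) * Λ₁ = 8 * D₁ * δ⁻¹ * Λ₁ := by field_simp
    exact (((((onum 8 (by norm_num) (by norm_num)).mul oD₁ hL).mul oδi hL).mul oΛ₁ hL).wk 10 0 hω hL (by norm_num) (by norm_num)).of_eq e1
  have oΘ₂ : OB om L 19 (1 / 8) Θ₂ := by
    rw [hΘ₂]
    have e1 : D₂ / (δ / 8) ^ 2 * Λ₁ ^ 2 + D₁ / (δ / 8) * Λ₂ = 64 * D₂ * δ⁻¹ * δ⁻¹ * Λ₁ ^ 2 + 8 * D₁ * δ⁻¹ * Λ₂ := by field_simp; ring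
    refine (OB.add ?_ ?_ hω).of_eq e1
    · exact (((((onum 64 (by norm_num) (by norm_num)).mul oD₂ hL).mul oδi hL).mul oδi hL).mul (oΛ₁.pow_two hL) hL).wk 18 (1 / 8) hω hL (by norm_num) (by norm_num)
    · exact ((((onum 8 (by norm_num) (by norm_num)).mul oD₁ hL).mul oδi hL).mul oΛ₂ hL).wk 18 (1 / 8) hω hL (by norm_num) (by norm_num)
  have osqδi : OB om L 1 0 (Real.sqrt δ)⁻¹ := ((oδi.sqrt hω hL).of_eq (Real.sqrt_inv δ).symm).wk 1 0 hω hL le_rfl (by norm_num)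
  have osqΔi : OB om L 1 0 (Real.sqrt Δ)⁻¹ := ((oΔi.sqrt hω hL).of_eq (Real.sqrt_inv Δ).symm).wk 1 0 hω hL le_rfl (by norm_num)
  have hsqΔiω : (Real.sqrt Δ)⁻¹ ≤ om := by have := osqΔi.le; rwa [pow_one, Real.rpow_zero, mul_one] at this
  have osq2Δi : OB om L 1 0 (Real.sqrt (2 * Δ))⁻¹ := by
    have h1 : (Real.sqrt (2 * Δ))⁻¹ ≤ (Real.sqrt Δ)⁻¹ := inv_anti₀ (Real.sqrt_pos.2 hΔ) (Real.sqrt_le_sqrt (by linarith))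
    exact osqΔi.of_le (inv_nonneg.2 (Real.sqrt_nonneg _)) h1
  have oS' : OB om L 21 0 S' := by
    rw [hS']
    have oΨ : OB om L 13 0 (2 * (D₁ + 1) / Real.sqrt δ + 8 * D₁ * Real.sqrt ((Δ + η) + δ) / δ) := by
      refine OB.add ?_ ?_ hω
      · have e1 : 2 * (D₁ + 1) / Real.sqrt δ = 2 * (D₁ + 1) * (Real.sqrt δ)⁻¹ := div_eq_mul_inv _ _
        exact (((o2.mul oD₁' hL).mul osqδi hL).wk 12 0 hω hL (by norm_num) (by norm_num)).of_eq e1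
      · have e1 : 8 * D₁ * Real.sqrt ((Δ + η) + δ) / δ = 8 * D₁ * Real.sqrt ((Δ + η) + δ) * δ⁻¹ := div_eq_mul_inv _ _
        have osum : OB om L 9 0 ((Δ + η) + δ) :=
          ((oΔ.wk 7 0 hω hL (by norm_num) (by norm_num)).add (oη'.wk 7 0 hω hL (by norm_num) (by norm_num)) hω).add (oδ.wk 8 0 hω hL (by norm_num) (by norm_num)) hω
        exact (((((onum 8 (by norm_num) (by norm_num)).mul oD₁ hL).mul ((osum.sqrt hω hL).wk 9 0 hω hL le_rfl (by norm_num)) hL).mul oδi hL).wk 12 0 hω hL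
          (by norm_num) (by norm_num)).of_eq e1
    have e2 : (2 * (D₁ + 1) / Real.sqrt δ + 8 * D₁ * Real.sqrt ((Δ + η) + δ) / δ) * Λ₁ / Real.sqrt (2 * Δ) =
        (2 * (D₁ + 1) / Real.sqrt δ + 8 * D₁ * Real.sqrt ((Δ + η) + δ) / δ) * Λ₁ * (Real.sqrt (2 * Δ))⁻¹ := div_eq_mul_inv _ _
    exact (((oΨ.mul oΛ₁ hL).mul osq2Δi hL).wk 21 0 hω hL (by norm_num) (by norm_num)).of_eq e2
  have oρ₁ : OB om L 5 (-(1 / 16)) (C * (V + 1 / T) * (V + V) * ℓ) :=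
    (((oC.mul (oV.add oTi' hω) hL).mul oVV hL).mul oℓ hL).wk 5 (-(1 / 16)) hω hL (by norm_num) (by norm_num)
  have oρc : OB om L 16 (-(1 / 16)) ρc := by
    rw [hρc]
    refine (((oρ₁.wk 14 (-(1 / 16)) hω hL (by norm_num) (by norm_num)).add ?_ hω).add ?_ hω)
    · have e1 : D₀ ^ 2 / 2 = D₀ ^ 2 * (1 / 2) := by ring
      exact (((oD₀'.pow_two hL).mul ohalf hL).wk 14 (-(1 / 16)) hω hL (by norm_num) (by norm_num)).of_eq e1
    · exact (oK.mul (oΘ₁.mul oD₀' hL) hL).wk 15 (-(1 / 16)) hω hL (by norm_num) (by norm_num)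
  have oD₁p : OB om L 4 0 (C * (V + V) + V) := (((oC.mul oVV hL).wk 3 0 hω hL (by norm_num) (by norm_num)).add (oV.wk 3 0 hω hL (by norm_num) (by norm_num)) hω)
  have oSc : OB om L 6 (1 / 16) (C * V * (V * ℓ⁻¹ + (V + V)) + K * (C * (1 / T) * V * ℓ⁻¹)) := by
    refine OB.add ?_ ?_ hω
    · exact ((oC.mul oV hL).mul (((oV.mul oℓi hL).wk 2 (1 / 16) hω hL (by norm_num) (by norm_num)).add (oVV.wk 2 (1 / 16) hω hL (by norm_num) (by norm_num)) hω) hL).wk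
        5 (1 / 16) hω hL (by norm_num) (by norm_num)
    · exact (oK.mul (((oC.mul oTi' hL).mul oV hL).mul oℓi hL) hL).wk 5 (1 / 16) hω hL (by norm_num) (by norm_num)
  have oSb₁ : OB om L 17 (1 / 16) Sb₁ := by
    rw [hSb₁]
    exact ((oSc.wk 15 (1 / 16) hω hL (by norm_num) (by norm_num)).add ((oD₀'.mul oD₁p hL).wk 15 (1 / 16) hω hL (by norm_num) (by norm_num)) hω).add
      ((oK.mul (oΘ₁.mul oD₁p hL) hL).wk 16 (1 / 16) hω hL (by norm_num) (by norm_num)) hω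
  have oSb₂ : OB om L 28 (1 / 16) Sb₂ := by
    rw [hSb₂]
    refine (((((oΘ₁.mul oρ₁ hL).wk 24 (1 / 16) hω hL (by norm_num) (by norm_num)).add (oSc.wk 24 (1 / 16) hω hL (by norm_num) (by norm_num)) hω).add
      ?_ hω).add ?_ hω).add ?_ hω
    · exact ((o2.mul oΘ₁ hL).mul (oD₀'.pow_two hL) hL).wk 25 (1 / 16) hω hL (by norm_num) (by norm_num)
    · exact (oD₀'.mul oD₁p hL).wk 26 (1 / 16) hω hL (by norm_num) (by norm_num)
    · exact (oK.mul (((oΘ₂.mul oD₀' hL).wk 22 (1 / 16) hω hL (by norm_num) (by norm_num)).add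
        ((oΘ₁.mul oD₁p hL).wk 22 (1 / 16) hω hL (by norm_num) (by norm_num)) hω) hL).wk 27 (1 / 16) hω hL (by norm_num) (by norm_num)
  -- `Θ₁ D₀ ≤ 1`, `Γ₁ ℓ ≤ 1`
  have hΘD : Θ₁ * D₀ ≤ 1 := (le_abs_self _).trans ((oΘ₁.mul oD₀' hL).le_one hω hL hM (by norm_num))
  set Γ₁ : ℝ := 2 * (D₁ + 1) * (2 / Real.sqrt (1 / 800)) ^ 3 * S' with hΓ₁
  have hcst0 : (0:ℝ) ≤ (2 / Real.sqrt (1 / 800)) ^ 3 := by positivity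
  have hcst : (2 / Real.sqrt (1 / 800) : ℝ) ^ 3 ≤ 200000 := by
    have h1 : Real.sqrt (1 / 800) = (Real.sqrt 800)⁻¹ := by rw [← Real.sqrt_inv]; norm_num
    have h8 : (0:ℝ) < Real.sqrt 800 := Real.sqrt_pos.2 (by norm_num)
    have h2 : (2 / Real.sqrt (1 / 800) : ℝ) = 2 * Real.sqrt 800 := by rw [h1]; field_simp
    have h3 : Real.sqrt 800 ≤ 29 := by rw [Real.sqrt_le_left (by norm_num)]; norm_num
    have h4 : (0:ℝ) ≤ Real.sqrt 800 := Real.sqrt_nonneg _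
    have h5 : (2 * Real.sqrt 800) ^ 3 ≤ (2 * 29) ^ 3 := pow_le_pow_left₀ (by positivity) (by linarith) 3
    rw [h2]; exact h5.trans (by norm_num)
  have oΓ₁ : OB om L 24 0 Γ₁ :=
    ((((o2.mul oD₁' hL).mul (onum _ hcst0 hcst) hL).mul oS' hL).wk 24 0 hω hL (by norm_num) (by norm_num))
  have hΓ₁0 : 0 ≤ Γ₁ := by simp only [hΓ₁]; positivity
  have hΓℓ : Γ₁ * ℓ ≤ 1 := (le_abs_self _).trans ((oΓ₁.mul oℓ hL).le_one hω hL hM (by norm_num))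
  have hΓℓi : Γ₁ ≤ ℓ⁻¹ := by
    have h := mul_le_mul_of_nonneg_right hΓℓ hℓi0
    rwa [mul_assoc, mul_inv_cancel₀ hℓpos.ne', mul_one, one_mul] at h
  -- ### Step 2: the jet parameters
  set lam : ℝ := L ^ (1 / B0) with hlam
  have hB0 : (0:ℝ) < B0 := by unfold JetStep.B0; norm_num
  have hlam1 : 1 ≤ lam := Real.one_le_rpow hL (by positivity)
  have hr := radius_fin_three
  set P : StepPars := ⟨T, lam ^ 4, lam ^ 10, 3200 * (C * δR), radius (Fin 3) * Δ / 3, ℓ, σN, L ^ (1 / 2 : ℝ), L ^ (13 / 16 : ℝ), L ^ (5 / 4 : ℝ)⟩ with hPdef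
  have hγ30 : radius (Fin 3) * Δ / 3 = Δ / 30 := by rw [hr]; ring
  have hγΔ : P.γ₀ = Δ / 30 := hγ30
  have hσpos : 0 < σN := by
    have : (0:ℝ) < (σN : ℝ) := by rw [hσN]; exact Real.rpow_pos_of_pos hLpos _
    exact_mod_cast this
  have hμ : pipeConc ≤ L ^ (13 / 16 : ℝ) := by
    have h1 : pipeConc ≤ om := by linarith only [hω₀', hC0, hK0, hCf0, hKf0, hD10, hD20, hMa.le, hL₀1, hTinv.le]
    have h2 : om ≤ om ^ (4000 * (13 / 16 : ℝ)) := by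
      rw [show (4000 : ℝ) * (13 / 16) = ((3250 : ℕ) : ℝ) by norm_num, Real.rpow_natCast]
      calc om = om ^ 1 := (pow_one om).symm
        _ ≤ om ^ 3250 := pow_le_pow_right₀ (by linarith) (by norm_num)
    exact h1.trans (h2.trans (omega_pow_le_rpow hω hM (by norm_num)))
  have hPδ : 0 < 3200 * (C * δR) := by positivity
  have hP : P.Valid := ⟨hT, one_le_pow₀ hlam1, one_le_pow₀ hlam1, hPδ, by show 0 < radius (Fin 3) * Δ / 3; rw [hγ30]; positivity,
    hℓpos, hℓ4, hℓT, hσpos, Real.one_le_rpow hL (by norm_num), hμ, Real.rpow_pos_of_pos hLpos _⟩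
  have hC₀1 : (1:ℝ) ≤ 100000000 * C := by linarith
  have hCδR0 : 0 ≤ C * δR := by positivity
  have hδRδ : δR ≤ δ := le_trans (le_mul_of_one_le_left hδR.le hC₀1) hC₀δ
  have hReg : P.RegimeW L lam := by
    refine ⟨hL, hlam1, le_rfl, hσN, rfl, rfl, rfl, rfl, rfl, rfl, ?_, ?_, ?_⟩
    · show 3200 * (C * δR) ≤ radius (Fin 3) * Δ / 3
      rw [hγ30, le_div_iff₀ (by norm_num : (0:ℝ) < 30)]
      have h1 : 3200 * (C * δR) * 30 ≤ 100000000 * C * δR := by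
        rw [show 3200 * (C * δR) * 30 = 96000 * (C * δR) by ring, show 100000000 * C * δR = 100000000 * (C * δR) by ring]
        exact mul_le_mul_of_nonneg_right (by norm_num) hCδR0
      linarith only [h1, hC₀δ, hδΔ, hΔ]
    · show radius (Fin 3) * Δ / 3 ≤ _; rw [hγ30]; exact hγ1
    · show _ ≤ radius (Fin 3) * Δ / 3; rw [hγ30]; exact hγlow
  -- the hypotheses of the jet step
  have hCA0 : 0 ≤ C * A := by positivity
  have h3201 : 3201 * (C * A) ≤ lam ^ 10 := by
    have h1 : 3201 * (C * A) ≤ 100000000 * (C * A) := mul_le_mul_of_nonneg_right (by norm_num) hCA0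
    have h2 : 100000000 * (C * A) = 100000000 * C * A := by ring
    linarith only [h1, h2, hC₀A]
  have hVbP : Vb ≤ P.V := by
    show Vb ≤ lam ^ 4
    have h1 : 0 ≤ (100000000 * C - 2 * C - 1) * V := mul_nonneg (by linarith only [hC1]) hV0
    have h2 : (100000000 * C - 2 * C - 1) * V = 100000000 * C * V - C * (V + V) - V := by ring
    rw [hVb]; linarith only [hΘD, hV1, h1, h2, hC₀V]
  have h3200 : 3200 * (C * A) ≤ lam ^ 10 := by linarith only [h3201, hCA0]
  have hNA' : ∀ t ∈ Icc 0 T, ∀ y, ‖N t y‖ ≤ P.A := fun t ht y => (hN0 t ht y).trans h3200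
  have hN1' : ∀ t ∈ Icc 0 T, ∀ y l, ‖Torus.partialDeriv l (N t) y‖ ≤ P.A * P.ℓ⁻¹ := fun t ht y l =>
    (hN1 t ht y l).trans (by
      show _ ≤ lam ^ 10 * ℓ⁻¹
      rw [show 3200 * (C * A * ℓ⁻¹) = 3200 * (C * A) * ℓ⁻¹ by ring]
      exact mul_le_mul_of_nonneg_right h3200 hℓi0)
  have hkey : Γ₁ * (C * A) + 3200 * (C * A * ℓ⁻¹) ≤ lam ^ 10 * ℓ⁻¹ := by
    have h1 : Γ₁ * (C * A) ≤ ℓ⁻¹ * (C * A) := mul_le_mul_of_nonneg_right hΓℓi hCA0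
    have h2 : ℓ⁻¹ * (C * A) + 3200 * (C * A * ℓ⁻¹) = 3201 * (C * A) * ℓ⁻¹ := by ring
    have h3 : 3201 * (C * A) * ℓ⁻¹ ≤ lam ^ 10 * ℓ⁻¹ := mul_le_mul_of_nonneg_right h3201 hℓi0
    linarith only [h1, h2, h3]
  have hNt' : ∀ t ∈ Icc 0 T, ∀ y, ‖Torus.timeDerivWithin (Icc 0 T) N t y‖ ≤ P.A * P.ℓ⁻¹ := fun t ht y => (hNt t ht y).trans hkey
  have hN2' : ∀ t ∈ Icc 0 T, ∀ y l m, ‖Torus.partialDeriv m (Torus.partialDeriv l (N t)) y‖ ≤ P.A * P.ℓ⁻¹ ^ 2 := fun t ht y l m =>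
    (hN2 t ht y l m).trans (by
      show _ ≤ lam ^ 10 * ℓ⁻¹ ^ 2
      rw [show 3200 * (C * A * ℓ⁻¹ ^ 2) = 3200 * (C * A) * ℓ⁻¹ ^ 2 by ring]
      exact mul_le_mul_of_nonneg_right h3200 (sq_nonneg _))
  have hNt1' : ∀ t ∈ Icc 0 T, ∀ y l, ‖Torus.timeDerivWithin (Icc 0 T) (fun s' z => Torus.partialDeriv l (N s') z) t y‖ ≤ P.A * P.ℓ⁻¹ ^ 2 := by
    intro t ht y l
    refine (hNt1 t ht y l).trans ?_
    show Γ₁ * (C * A * ℓ⁻¹) + 3200 * (C * A * ℓ⁻¹ ^ 2) ≤ lam ^ 10 * ℓ⁻¹ ^ 2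
    have h1 := mul_le_mul_of_nonneg_right hkey hℓi0
    have e1 : Γ₁ * (C * A * ℓ⁻¹) + 3200 * (C * A * ℓ⁻¹ ^ 2) = (Γ₁ * (C * A) + 3200 * (C * A * ℓ⁻¹)) * ℓ⁻¹ := by ring
    have e2 : lam ^ 10 * ℓ⁻¹ ^ 2 = lam ^ 10 * ℓ⁻¹ * ℓ⁻¹ := by ring
    rw [e1, e2]; exact h1
  obtain ⟨v', p', R', hns', hmean', hL2', hL1', hsup', hC0', hC1', hCt', hE', hloc'⟩ :=
    hjet P ν e vb pb Rcb N s Gm Δ δ ρc S' hP hν hν1 rfl hδ hNSRb hvbmean hRcbS hRcbsym hRcbtr hNS hNsym hss hs01 hs' hsflat hs_sq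
      (fun t ht y => (hvb0 t ht y).trans hVbP) (fun i t ht y => (hvb1 i t ht y).trans hVbP) (fun t ht y => (hvbt t ht y).trans hVbP)
      hRcb0 hNA' hN1' hNt' hN2' hNt1' hNL1
  -- ### Step 3: power counting of the jet sizes
  have hL₀L : L₀ ≤ L := le_trans (by linarith only [hω₀', hC0, hK0, hCf0, hKf0, hD10, hD20, hMa.le, hpipe, hTinv.le]) hωL
  obtain ⟨hEp, hL1b, hX1, hSupb, hX2, hC0b, hC1b, hCtb, hSwb, hLin, hEr, hsqEr, hNNb⟩ := harithT hP hReg rfl hL₀L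
  have hγ₀Δ : P.γ₀ ≤ Δ := by rw [hγΔ]; linarith only [hΔ]
  have oγ : OB om L 1 0 (Real.sqrt P.γ₀) :=
    ((oΔ.sqrt hω hL).wk 1 0 hω hL le_rfl (by norm_num)).of_le (Real.sqrt_nonneg _) (Real.sqrt_le_sqrt hγ₀Δ)
  -- the sizes handed to the final gluing
  set W₀ : ℝ := max 1 (P.stepC0 c) with hW₀
  set W₁ : ℝ := max 0 (P.stepC1 c) with hW₁
  set W₂ : ℝ := max 0 (P.stepCt c + S' * (2 * P.Sw c)) with hW₂
  set S₀ : ℝ := max 0 (2 * ρc + P.stepSup c + c.Kℛ * (S' * (P.Sp c + P.Sc c + 2 * P.D.XSup (P.A₀ c) c.B))) with hS₀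
  set L₁ : ℝ := max 0 (2 * ρc + P.stepL1 c + S' * (c.C₁ * (P.Lp c + P.Lc c + 2 * Real.sqrt (P.EX c)))) with hL₁
  set εE : ℝ := errE c P + (18 / radius (Fin 3) + 3) * P.δ with hεE
  set ℓ₂ : ℝ := L ^ (-(8 : ℝ)) with hℓ₂
  have hℓ₂pos : 0 < ℓ₂ := Real.rpow_pos_of_pos hLpos _
  have hℓ₂inv : ℓ₂⁻¹ = L ^ (8 : ℝ) := by rw [hℓ₂, Real.rpow_neg hLpos.le, inv_inv]
  have hℓ₂ℓ : ℓ₂ ≤ ℓ := Real.rpow_le_rpow_of_exponent_le hL (by norm_num)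
  have hℓ₂4 : ℓ₂ ≤ 1 / 4 := hℓ₂ℓ.trans hℓ4
  have hℓ₂T : 8 * ℓ₂ ≤ T := by linarith only [hℓ₂ℓ, hℓT]
  have oℓ₂ : OB om L 0 (-8) ℓ₂ := OB.rpow om hL _
  have oℓ₂i : OB om L 0 8 ℓ₂⁻¹ := (OB.rpow om hL _).of_eq hℓ₂inv
  have hW₀1 : 1 ≤ W₀ := le_max_left _ _
  have hW₁0 : 0 ≤ W₁ := le_max_left _ _
  have hW₂0 : 0 ≤ W₂ := le_max_left _ _
  have hS₀0 : 0 ≤ S₀ := le_max_left _ _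
  have hL₁0 : 0 ≤ L₁ := le_max_left _ _
  have oW₀ : OB om L 0 2 W₀ := by
    have h1 : W₀ ≤ L ^ (2 : ℝ) := max_le (Real.one_le_rpow hL (by norm_num)) hC0b
    show |W₀| ≤ _; rw [abs_of_nonneg (le_trans zero_le_one hW₀1), pow_zero, one_mul]; exact h1
  have oW₁ : OB om L 0 4 W₁ := by
    have h1 : W₁ ≤ L ^ (4 : ℝ) := max_le (Real.rpow_nonneg hLpos.le _) hC1b
    show |W₁| ≤ _; rw [abs_of_nonneg hW₁0, pow_zero, one_mul]; exact h1
  have oW₂ : OB om L 23 4 W₂ := by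
    have h1 : W₂ ≤ L ^ (4 : ℝ) + S' * (2 * L ^ (2 : ℝ)) := max_le (by positivity) (add_le_add hCtb (mul_le_mul_of_nonneg_left (by linarith only [hSwb]) hS'0))
    have o3 : OB om L 23 4 (L ^ (4 : ℝ) + S' * (2 * L ^ (2 : ℝ))) :=
      ((OB.rpow om hL 4).wk 22 4 hω hL (by norm_num) (by norm_num)).add ((oS'.mul (o2.mul (OB.rpow om hL 2) hL) hL).wk 22 4 hω hL (by norm_num) (by norm_num)) hω
    exact o3.of_le hW₂0 h1
  have oS₀ : OB om L 24 6 S₀ := by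
    have h1 : S₀ ≤ 2 * ρc + L ^ (6 : ℝ) + S' * L ^ (2 : ℝ) := by
      refine max_le (by positivity) (add_le_add (add_le_add le_rfl hSupb) ?_)
      rw [show c.Kℛ * (S' * (P.Sp c + P.Sc c + 2 * P.D.XSup (P.A₀ c) c.B)) = S' * (c.Kℛ * (P.Sp c + P.Sc c + 2 * P.D.XSup (P.A₀ c) c.B)) by ring]
      exact mul_le_mul_of_nonneg_left hX2 hS'0
    have o3 : OB om L 24 6 (2 * ρc + L ^ (6 : ℝ) + S' * L ^ (2 : ℝ)) :=
      (((o2.mul oρc hL).wk 22 6 hω hL (by norm_num) (by norm_num)).add ((OB.rpow om hL 6).wk 22 6 hω hL (by norm_num) (by norm_num)) hω).add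
        ((oS'.mul (OB.rpow om hL 2) hL).wk 23 6 hω hL (by norm_num) (by norm_num)) hω
    exact o3.of_le hS₀0 h1
  have oL₁ : OB om L 23 (-(11 / 200)) L₁ := by
    have h1 : L₁ ≤ 2 * ρc + L ^ (-(11 / 200 : ℝ)) + S' * L ^ (-(1 / 8 : ℝ)) :=
      max_le (by positivity) (add_le_add (add_le_add le_rfl hL1b) (mul_le_mul_of_nonneg_left hX1 hS'0))
    have o3 : OB om L 23 (-(11 / 200)) (2 * ρc + L ^ (-(11 / 200 : ℝ)) + S' * L ^ (-(1 / 8 : ℝ))) :=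
      (((o2.mul oρc hL).wk 21 (-(11 / 200)) hω hL (by norm_num) (by norm_num)).add ((OB.rpow om hL _).wk 21 (-(11 / 200)) hω hL (by norm_num) (by norm_num)) hω).add
        ((oS'.mul (OB.rpow om hL _) hL).wk 22 (-(11 / 200)) hω hL (by norm_num) (by norm_num)) hω
    exact o3.of_le hL₁0 h1
  have hpr : Real.sqrt (P.Ep c) * Real.sqrt (P.Er c) ≤ Ma * Real.sqrt P.γ₀ * L ^ (-(1 / 10 : ℝ)) :=
    mul_le_mul hEp hsqEr (Real.sqrt_nonneg _) (by positivity)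
  have herrE : errE c P ≤ L ^ (-(1 / 8 : ℝ)) + (2 * (Ma * Real.sqrt P.γ₀ * L ^ (-(1 / 10 : ℝ))) + L ^ (-(1 / 5 : ℝ))) + L ^ (-(1 / 10 : ℝ)) := by
    rw [errE_def]; linarith only [hLin, hpr, hEr, hNNb]
  have oerrUB : OB om L 6 (-(1 / 10)) (L ^ (-(1 / 8 : ℝ)) + (2 * (Ma * Real.sqrt P.γ₀ * L ^ (-(1 / 10 : ℝ))) + L ^ (-(1 / 5 : ℝ))) + L ^ (-(1 / 10 : ℝ))) :=
    ((((OB.rpow om hL (-(1 / 8))).wk 4 (-(1 / 10)) hω hL (by norm_num) (by norm_num)).add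
      ((((o2.mul ((oMa.mul oγ hL).mul (OB.rpow om hL _) hL) hL).wk 3 (-(1 / 10)) hω hL (by norm_num) (by norm_num)).add
        ((OB.rpow om hL (-(1 / 5))).wk 3 (-(1 / 10)) hω hL (by norm_num) (by norm_num)) hω)) hω).add
      ((OB.rpow om hL (-(1 / 10))).wk 5 (-(1 / 10)) hω hL (by norm_num) (by norm_num)) hω)
  -- ### Step 4: the final gluing
  have hagree : ∀ t ∈ Icc 0 T, Gm t ≤ 3 * δ / 8 → v' t = vb t ∧ R' t = Rcb t := fun t ht hG => hloc' t ht ((hs_zero t).2 hG)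
  have huntouched' : ∀ t ∈ Icc 0 T, Gm t ≤ δ / 8 → v' t = v t ∧ R' t = 0 := by
    intro t ht hG
    obtain ⟨h1, h2⟩ := hagree t ht (by linarith only [hG, hδ])
    obtain ⟨h3, h4⟩ := huntouched t ht hG
    exact ⟨h1.trans h3, h2.trans h4⟩
  have oD₂ : OB om L 25 (-4) (Cf * (W₂ + W₁) * ℓ₂) :=
    ((oCf.mul (oW₂.add (oW₁.wk 23 4 hω hL (by norm_num) (by norm_num)) hω) hL).mul oℓ₂ hL).wk 25 (-4) hω hL (by norm_num) (by norm_num)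
  have hsmall₂ : η + εE + (2 * (Cf * W₀) + Cf * (W₂ + W₁) * ℓ₂) * (Cf * (W₂ + W₁) * ℓ₂) ≤ δ / 10 := by
    have h1 : η ≤ δ / 256 := oη'.le_div_of_inv_le hω hL hM hδ hδiω (by norm_num)
    have h2 : errE c P ≤ δ / 256 := herrE.trans (oerrUB.le_div_of_inv_le hω hL hM hδ hδiω (by norm_num))
    have h3 : (18 / radius (Fin 3) + 3) * P.δ ≤ δ / 40 := by
      show (18 / radius (Fin 3) + 3) * (3200 * (C * δR)) ≤ δ / 40
      rw [hr, le_div_iff₀ (by norm_num : (0:ℝ) < 40)]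
      have e1 : (18 / (1 / 10) + 3) * (3200 * (C * δR)) * 40 = 23424000 * (C * δR) := by ring
      rw [e1]
      have e3 : 100000000 * C * δR = 100000000 * (C * δR) := by ring
      linarith only [hC₀δ, hCδR0, e3]
    have h4 : (2 * (Cf * W₀) + Cf * (W₂ + W₁) * ℓ₂) * (Cf * (W₂ + W₁) * ℓ₂) ≤ δ / 256 :=
      (((((o2.mul (oCf.mul oW₀ hL) hL).wk 25 2 hω hL (by norm_num) (by norm_num)).add (oD₂.wk 25 2 hω hL (by norm_num) (by norm_num)) hω).mul oD₂ hL).wk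
        51 (-2) hω hL (by norm_num) (by norm_num)).le_div_of_inv_le hω hL hM hδ hδiω (by norm_num)
    have e2 : εE = errE c P + (18 / radius (Fin 3) + 3) * P.δ := rfl
    rw [e2]; linarith only [h1, h2, h3, h4, hδ]
  obtain ⟨vn, pn, Rn, D₂, ρ₂, S₁, hD₂, hρ₂, hS₁, hnsn, hmeann, hvn0, hvn1, hvnt, hvnv, hRn0, hRnL1, hRn1, hRnt, hgapn, h26n⟩ :=
    hfinal T ν e v vb v' p' Rcb R' θ Gm W₀ W₁ W₂ S₀ L₁ Θ₁ Θ₂ Sb₁ Sb₂ δ η εE ℓ₂ hT hns' hmean' hns.smooth_velocity hNSRb.smooth_velocity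
      hθs hθ01 hθ' hθ'' hθflat hθne1 hθne0 hGms.continuousOn hagree hquiet hSb₁0 hSb₂0 huntouched' hW₀1 hW₁0 hW₂0 hS₀0 hL₁0
      (fun t ht y => (hC0' t ht y).trans (le_max_right _ _)) (fun i t ht y => (hC1' t ht y i).trans (le_max_right _ _))
      (fun t ht y => (hCt' t ht y).trans (le_max_right _ _)) (fun t ht y => (hsup' t ht y).trans (le_max_right _ _))
      (fun t ht => (hL1' t ht).trans (le_max_right _ _)) hδ (fun t ht => (hgap t ht).1) hGGm hGbGm hE' hℓ₂pos hℓ₂4 hℓ₂T hsmall₂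
  -- ### Step 5: collapsing the final sizes
  have oD₂' : OB om L 25 (-4) D₂ := oD₂.of_eq hD₂
  have oW21 : OB om L 24 4 (W₂ + W₁) := oW₂.add (oW₁.wk 23 4 hω hL (by norm_num) (by norm_num)) hω
  have oρ₂ : OB om L 27 (-2) ρ₂ := by
    rw [hρ₂]
    exact (((oCf.mul ((oW₀.wk 1 2 hω hL (by norm_num) (by norm_num)).add (oTi'.wk 1 2 hω hL (by norm_num) (by norm_num)) hω) hL).mul oW21 hL).mul oℓ₂ hL).wk
      27 (-2) hω hL (by norm_num) (by norm_num)
  have oS₁ : OB om L 28 14 S₁ := by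
    rw [hS₁]
    refine (OB.add (OB.add ?_ ?_ hω) ?_ hω)
    · exact ((oCf.mul oW₀ hL).mul (((oW₀.mul oℓ₂i hL).wk 24 10 hω hL (by norm_num) (by norm_num)).add (oW21.wk 24 10 hω hL (by norm_num) (by norm_num)) hω) hL).wk
        26 14 hω hL (by norm_num) (by norm_num)
    · exact (oKf.mul (((oCf.mul oTi' hL).mul oW₀ hL).mul oℓ₂i hL) hL).wk 26 14 hω hL (by norm_num) (by norm_num)
    · exact ((onum 4 (by norm_num) (by norm_num)).mul ((oCf.mul oS₀ hL).mul oℓ₂i hL) hL).wk 27 14 hω hL (by norm_num) (by norm_num)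
  have oD₂p : OB om L 26 4 (Cf * (W₂ + W₁) + W₁) := (((oCf.mul oW21 hL).wk 25 4 hω hL (by norm_num) (by norm_num)).add (oW₁.wk 25 4 hω hL (by norm_num) (by norm_num)) hω)
  have oD₂t : OB om L 26 4 (Cf * (W₂ + W₁) + W₂) := (((oCf.mul oW21 hL).wk 25 4 hω hL (by norm_num) (by norm_num)).add (oW₂.wk 25 4 hω hL (by norm_num) (by norm_num)) hω)
  have oD₂sq : OB om L 50 (-8) (D₂ ^ 2 / 2) := (((oD₂'.pow_two hL).mul ohalf hL).wk 50 (-8) hω hL (by norm_num) (by norm_num)).of_eq (by ring)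
  have oKΘD : OB om L 36 (-4) (Kf * (Θ₁ * D₂)) := (oKf.mul (oΘ₁.mul oD₂' hL) hL).wk 36 (-4) hω hL (by norm_num) (by norm_num)
  -- velocity
  have ov0 : OB om L 1 2 (Cf * W₀) := (oCf.mul oW₀ hL).wk 1 2 hω hL (by norm_num) (by norm_num)
  have ov1 : OB om L 27 4 (Cf * (W₂ + W₁) + W₁) := oD₂p.wk 27 4 hω hL (by norm_num) (by norm_num)
  have ovt : OB om L 36 4 ((Cf * (W₂ + W₁) + W₂) + Θ₁ * D₂) :=
    (oD₂t.wk 35 4 hω hL (by norm_num) (by norm_num)).add ((oΘ₁.mul oD₂' hL).wk 35 4 hω hL (by norm_num) (by norm_num)) hω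
  -- stress
  have oRL1 : OB om L 52 (-(11 / 200)) (L₁ + (ρ₂ + 2 * (Cf * L₁)) + D₂ ^ 2 / 2 + Kf * (Θ₁ * D₂)) :=
    ((((oL₁.wk 28 (-(11 / 200)) hω hL (by norm_num) (by norm_num)).add (((oρ₂.wk 27 (-(11 / 200)) hω hL (by norm_num) (by norm_num)).add
      ((o2.mul (oCf.mul oL₁ hL) hL).wk 27 (-(11 / 200)) hω hL (by norm_num) (by norm_num)) hω)) hω).wk 50 (-(11 / 200)) hω hL (by norm_num) (by norm_num)).add
      (oD₂sq.wk 50 (-(11 / 200)) hω hL (by norm_num) (by norm_num)) hω).add (oKΘD.wk 51 (-(11 / 200)) hω hL (by norm_num) (by norm_num)) hω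
  have oR0 : OB om L 52 6 (S₀ + (ρ₂ + 2 * (Cf * S₀)) + D₂ ^ 2 / 2 + Kf * (Θ₁ * D₂)) :=
    ((((oS₀.wk 28 6 hω hL (by norm_num) (by norm_num)).add (((oρ₂.wk 27 6 hω hL (by norm_num) (by norm_num)).add
      ((o2.mul (oCf.mul oS₀ hL) hL).wk 27 6 hω hL (by norm_num) (by norm_num)) hω)) hω).wk 50 6 hω hL (by norm_num) (by norm_num)).add
      (oD₂sq.wk 50 6 hω hL (by norm_num) (by norm_num)) hω).add (oKΘD.wk 51 6 hω hL (by norm_num) (by norm_num)) hω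
  have oR1 : OB om L 53 14 (Sb₁ + S₁ + D₂ * (Cf * (W₂ + W₁) + W₁) + Kf * (Θ₁ * (Cf * (W₂ + W₁) + W₁))) :=
    (((((oSb₁.wk 28 14 hω hL (by norm_num) (by norm_num)).add oS₁ hω).wk 51 14 hω hL (by norm_num) (by norm_num)).add
      ((oD₂'.mul oD₂p hL).wk 51 14 hω hL (by norm_num) (by norm_num)) hω).add ((oKf.mul (oΘ₁.mul oD₂p hL) hL).wk 52 14 hω hL (by norm_num) (by norm_num)) hω)
  have oRt : OB om L 66 14 (Θ₁ * (S₀ + (ρ₂ + 2 * (Cf * S₀))) + Sb₂ + S₁ + 2 * Θ₁ * D₂ ^ 2 + D₂ * (Cf * (W₂ + W₁) + W₂) +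
      Kf * (Θ₂ * D₂ + Θ₁ * (Cf * (W₂ + W₁) + W₂))) := by
    have t1 : OB om L 39 6 (Θ₁ * (S₀ + (ρ₂ + 2 * (Cf * S₀)))) :=
      (oΘ₁.mul ((oS₀.wk 28 6 hω hL (by norm_num) (by norm_num)).add (((oρ₂.wk 27 6 hω hL (by norm_num) (by norm_num)).add
        ((o2.mul (oCf.mul oS₀ hL) hL).wk 27 6 hω hL (by norm_num) (by norm_num)) hω)) hω) hL).wk 39 6 hω hL (by norm_num) (by norm_num)
    have t4 : OB om L 61 (-8) (2 * Θ₁ * D₂ ^ 2) := ((o2.mul oΘ₁ hL).mul (oD₂'.pow_two hL) hL).wk 61 (-8) hω hL (by norm_num) (by norm_num)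
    have t5 : OB om L 51 0 (D₂ * (Cf * (W₂ + W₁) + W₂)) := (oD₂'.mul oD₂t hL).wk 51 0 hω hL (by norm_num) (by norm_num)
    have t6 : OB om L 46 4 (Kf * (Θ₂ * D₂ + Θ₁ * (Cf * (W₂ + W₁) + W₂))) :=
      (oKf.mul (((oΘ₂.mul oD₂' hL).wk 44 4 hω hL (by norm_num) (by norm_num)).add ((oΘ₁.mul oD₂t hL).wk 44 4 hω hL (by norm_num) (by norm_num)) hω) hL).wk
        46 4 hω hL (by norm_num) (by norm_num)
    exact ((((((t1.wk 61 14 hω hL (by norm_num) (by norm_num)).add (oSb₂.wk 61 14 hω hL (by norm_num) (by norm_num)) hω).add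
      (oS₁.wk 62 14 hω hL (by norm_num) (by norm_num)) hω).add (t4.wk 63 14 hω hL (by norm_num) (by norm_num)) hω).add
      (t5.wk 64 14 hω hL (by norm_num) (by norm_num)) hω).add (t6.wk 65 14 hω hL (by norm_num) (by norm_num)) hω)
  -- the `L²` increment
  have oL2 : OB om L 27 (-(1 / 16)) (D₂ + Real.sqrt (P.Er c) + D₀) :=
    (((oD₂'.wk 25 (-(1 / 16)) hω hL (by norm_num) (by norm_num)).add (((OB.rpow om hL (-(1 / 10))).of_le (Real.sqrt_nonneg _) hsqEr).wk 25 (-(1 / 16)) hω hL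
      (by norm_num) (by norm_num)) hω).add (oD₀'.wk 26 (-(1 / 16)) hω hL (by norm_num) (by norm_num)) hω)
  have hjunk : D₂ + Real.sqrt (P.Er c) + D₀ ≤ Real.sqrt Δ := by
    have := oL2.le_mul_of_inv_le hω hL hM (Real.sqrt_pos.2 hΔ) hsqΔiω (f := 0) (by norm_num)
    rwa [Real.rpow_zero, one_mul] at this
  have hEpΔ : Real.sqrt (P.Ep c) ≤ Ma * Real.sqrt Δ := hEp.trans (mul_le_mul_of_nonneg_left (Real.sqrt_le_sqrt hγ₀Δ) hMa.le)
  have hD₂0 : 0 ≤ D₂ := by rw [hD₂]; positivity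
  -- ### Assembly
  refine ⟨vn, pn, Rn, hnsn, hmeann, fun t ht x => (hvn0 t ht x).trans (ov0.le_div_five hω hL hM (by norm_num)),
    fun i t ht x => (hvn1 i t ht x).trans (ov1.le_div_five hω hL hM (by norm_num)),
    fun t ht x => (hvnt t ht x).trans (ovt.le_div_five hω hL hM (by norm_num)),
    fun t ht => (hRnL1 t ht).trans (oRL1.le_mul_of_inv_le hω hL hM hδ hδiω (by norm_num)),
    fun t ht x => (hRn0 t ht x).trans (oR0.le_div_five hω hL hM (by norm_num)),
    fun l t ht x => (hRn1 t ht x l).trans (oR1.le_div_five hω hL hM (by norm_num)),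
    fun t ht x => (hRnt t ht x).trans (oRt.le_div_five hω hL hM (by norm_num)), hgapn, h26n, fun t ht => ?_⟩
  -- the `L²` increment at time `t`
  have hvnS := hnsn.smooth_velocity
  have hv'S := hns'.smooth_velocity
  have hvbS := hNSRb.smooth_velocity
  have hvS := hns.smooth_velocity
  have m1 : AEStronglyMeasurable (vn t - v' t) volume := ((hvnS.isSmooth_slice ht).continuous.sub (hv'S.isSmooth_slice ht).continuous).aestronglyMeasurable
  have m2 : AEStronglyMeasurable (v' t - vb t) volume := ((hv'S.isSmooth_slice ht).continuous.sub (hvbS.isSmooth_slice ht).continuous).aestronglyMeasurable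
  have m3 : AEStronglyMeasurable (vb t - v t) volume := ((hvbS.isSmooth_slice ht).continuous.sub (hvS.isSmooth_slice ht).continuous).aestronglyMeasurable
  have e1 : vn t - v t = (vn t - v' t) + (v' t - vb t) + (vb t - v t) := by abel
  have hsup : ∀ {f : (UnitAddTorus (Fin 3)) → (EuclideanSpace ℝ (Fin 3))} {B : ℝ}, (∀ x, ‖f x‖ ≤ B) → eLpNorm f 2 volume ≤ ENNReal.ofReal B := by
    intro f B hB
    have := eLpNorm_le_of_ae_bound (p := (2 : ℝ≥0∞)) (μ := (volume : Measure (UnitAddTorus (Fin 3)))) (f := f) (Filter.Eventually.of_forall hB)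
    simpa using this
  have b1 : eLpNorm (vn t - v' t) 2 volume ≤ ENNReal.ofReal D₂ := hsup fun x => by simpa using hvnv t ht x
  have b3 : eLpNorm (vb t - v t) 2 volume ≤ ENNReal.ofReal D₀ := hsup fun x => by simpa using hvbv t ht x
  have b2 := hL2' t ht
  calc eLpNorm (vn t - v t) 2 volume ≤ eLpNorm (vn t - v' t) 2 volume + eLpNorm (v' t - vb t) 2 volume + eLpNorm (vb t - v t) 2 volume := by
        rw [e1]; exact (eLpNorm_add_le (m1.add m2) m3 (by norm_num)).trans (add_le_add (eLpNorm_add_le m1 m2 (by norm_num)) le_rfl)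
    _ ≤ ENNReal.ofReal D₂ + ENNReal.ofReal (Real.sqrt (P.Ep c) + Real.sqrt (P.Er c)) + ENNReal.ofReal D₀ := add_le_add (add_le_add b1 b2) b3
    _ = ENNReal.ofReal (D₂ + (Real.sqrt (P.Ep c) + Real.sqrt (P.Er c)) + D₀) := by
        rw [← ENNReal.ofReal_add hD₂0 (by positivity), ← ENNReal.ofReal_add (by positivity) hD₀0]
    _ ≤ ENNReal.ofReal ((Ma + 1) * Real.sqrt Δ) := ENNReal.ofReal_le_ofReal (by linarith only [hjunk, hEpΔ])

end EnergyPump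

end Literature.Analysis.FluidPDE
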